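import Summits.HodgeConjecture.HodgeConjecture.Theses.NikulinTwinTransport

/-!
# Negative knowledge for crux `NikulinSerreCarrier` (stmt-HodgeConjecture-14464): certified cores

Sorry-free cores extracted from the disproof work-file `Cruxes/NikulinSerreCarrier/Disproof.lean`
(refuter-cdisprove-stmt-HodgeConjecture-14464-g2-0): lattice parity of `E₈(−2)` and evenness of the
carrier multiplicity `m` (§A), the mixed-block energy identity behind the sign law `m > 0` (§C), and the
leaf-degree / charge arithmetic of the symplectic rigidity theorem along the nodal curves (§K).  See the
work-file docblock for the geometric statements these certify.
-/

namespace Summit.HodgeConjecture.HodgeConjecture.Theorems.NikulinSerreCarrier.Negative.NodalRigidity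

open Matrix Finset

section LatticeParity

/-- The `E₈` form is even: `vᵀ E₈ v ∈ 2ℤ` for every integral `v` (Bourbaki Cartan matrix of Mathlib).
Hence `E₈(−2) = E₈` scaled by `−2` has all norms in `4ℤ`. -/
theorem E8_form_even (v : Fin 8 → ℤ) : Even (v ⬝ᵥ (CartanMatrix.E₈ *ᵥ v)) := by
  refine ⟨v 0 ^ 2 + v 1 ^ 2 + v 2 ^ 2 + v 3 ^ 2 + v 4 ^ 2 + v 5 ^ 2 + v 6 ^ 2 + v 7 ^ 2
      - (v 0 * v 2 + v 1 * v 3 + v 2 * v 3 + v 3 * v 4 + v 4 * v 5 + v 5 * v 6 + v 6 * v 7), ?_⟩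
  simp [CartanMatrix.E₈, Matrix.mulVec, dotProduct, Fin.sum_univ_eight]
  ring

/-- Norms of the twisted lattice `E₈(−2)` (Gram matrix `−2·E₈`) are divisible by `4`. -/
theorem E8_neg2_norm_dvd_four (v : Fin 8 → ℤ) :
    (4 : ℤ) ∣ v ⬝ᵥ (((-2 : ℤ) • CartanMatrix.E₈) *ᵥ v) := by
  obtain ⟨k, hk⟩ := E8_form_even v
  refine ⟨-k, ?_⟩
  rw [Matrix.smul_mulVec, dotProduct_smul, hk, smul_eq_mul]
  ring

/-- **(E1)-core.** `E₈(−2)` contains no `(−2)`-vector: no class of `E₈(−2) ⊂ NS(X)` is the class of a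
smooth rational curve, and (with `L·E₈(−2) = 0`, `L` ample) no nonzero class of `E₈(−2)` is effective. -/
theorem E8_neg2_no_root (v : Fin 8 → ℤ) :
    v ⬝ᵥ (((-2 : ℤ) • CartanMatrix.E₈) *ᵥ v) ≠ -2 := by
  intro h
  have h4 := E8_neg2_norm_dvd_four v
  rw [h] at h4
  omega

/-- **K1-integrality core.** For pairwise orthogonal `(−4)`-vectors `r, s` the half-sum `½(r+s)` has
norm `−2`; by `E8_neg2_no_root` it is not in `E₈(−2)`, so `Ψ = g^* ⊕ (N_j ↦ r_j)` is not integral on the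
Nikulin glue `½(N_i+N_j) + ½m_{ij}`: `Ψ` is rational with `2Ψ` integral. -/
theorem half_sum_norm {M : Type*} [AddCommGroup M] [Module ℚ M] (B : LinearMap.BilinForm ℚ M)
    (r s : M) (hr : B r r = -4) (hs : B s s = -4) (hrs : B r s = 0) (hsr : B s r = 0) :
    B ((1 / 2 : ℚ) • (r + s)) ((1 / 2 : ℚ) • (r + s)) = -2 := by
  simp only [map_add, map_smul, LinearMap.add_apply, LinearMap.smul_apply, smul_eq_mul, hr, hs, hrs,
    hsr]
  norm_num

/-- **`m` is even.** If `graph Ψ ∉ H⁴(X×Y′,ℤ)` but `2·graph Ψ` is integral, then an integral class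
`m·graph Ψ` (the mixed Künneth component of `c₂(G)`, integral because the pure components `n_X[pt]⊗1`,
`1⊗n_Y[pt]` are) forces `2 ∣ m`.  Abstract form over any lattice `Λ` in a group `V`. -/
theorem m_even_of_halfIntegral {V : Type*} [AddCommGroup V] (Λ : AddSubgroup V) (g : V)
    (h2 : (2 : ℤ) • g ∈ Λ) (hg : g ∉ Λ) (m : ℤ) (hm : m • g ∈ Λ) : Even m := by
  by_contra hodd
  rw [Int.not_even_iff_odd] at hodd
  obtain ⟨k, hk⟩ := hodd
  apply hg
  have key : g = m • g - k • ((2 : ℤ) • g) := by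
    rw [hk, smul_smul, ← sub_smul]
    have : (2 * k + 1 - k * 2 : ℤ) = 1 := by ring
    rw [this, one_smul]
  rw [key]
  exact Λ.sub_mem hm (Λ.zsmul_mem h2 k)

end LatticeParity

section SignLaw

variable {ι κ : Type*} [Fintype ι] [Fintype κ]

/-- **Mixed-block energy identity.**  `I` (resp. `I′`) is the matrix of the complex structure of `T_xX`
(resp. `T_yY′`) in an orthonormal frame (`I² = −1`; orthogonality is not even needed), `B` a
`𝔲(r)`-component of the MIXED curvature block `Θ_m ∈ T^*X ⊗ T^*Y′` of a connection of type `(1,1)`: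
invariance under the diagonal circle `(e^{tI}, e^{tI′})` reads `B I′ = I B`.  The density of
`tr(Θ_m ∧ Θ_m) ∧ ω_X ∧ ω_{Y′}` is `−tr(I B I′ Bᵀ)` per component, and this equals `‖B‖²`. -/
theorem mixedBlock_energy [DecidableEq ι] (I : Matrix ι ι ℝ) (I' : Matrix κ κ ℝ)
    (B : Matrix ι κ ℝ) (hI : I * I = -1) (hB : B * I' = I * B) :
    -Matrix.trace (I * B * I' * Bᵀ) = Matrix.trace (B * Bᵀ) := by
  have key : I * B * I' * Bᵀ = -(B * Bᵀ) := by
    rw [Matrix.mul_assoc I B I', hB, ← Matrix.mul_assoc I I B, hI]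
    simp
  rw [key, Matrix.trace_neg, neg_neg]

/-- `tr(B Bᵀ) = Σ B_{ij}²`. -/
theorem trace_mul_transpose_self_eq_sum (B : Matrix ι κ ℝ) :
    Matrix.trace (B * Bᵀ) = ∑ i, ∑ j, B i j ^ 2 := by
  simp [Matrix.trace, Matrix.mul_apply, sq]

/-- `tr(B Bᵀ) ≥ 0`: with `mixedBlock_energy` and anti-self-duality of the pure blocks
(`Θ_XX ∧ ω_X = 0 = Θ_YY ∧ ω_{Y′}`, from `SU(2)_X`-, `SU(2)_{Y′}`-invariance of the pure blocks of an
`SU(2)_Δ`-invariant form) this gives `m·ω² = ∫ c₂(G) ∧ ω ⊗ ω′ = (8π²)⁻¹ ‖Θ_mixed‖² ≥ 0`. -/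
theorem trace_mul_transpose_self_nonneg (B : Matrix ι κ ℝ) : 0 ≤ Matrix.trace (B * Bᵀ) := by
  rw [trace_mul_transpose_self_eq_sum]
  exact Finset.sum_nonneg fun i _ => Finset.sum_nonneg fun j _ => sq_nonneg _

/-- … with equality iff the mixed block vanishes (`m = 0` iff the hyperholomorphic connection is locally a
product, in which case `c₂^{(2,2)} = 0`): so `m > 0` for every genuine carrier. -/
theorem trace_mul_transpose_self_eq_zero_iff (B : Matrix ι κ ℝ) :
    Matrix.trace (B * Bᵀ) = 0 ↔ B = 0 := by
  rw [trace_mul_transpose_self_eq_sum]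
  constructor
  · intro h
    ext i j
    have hi := (Finset.sum_eq_zero_iff_of_nonneg (fun i _ =>
      Finset.sum_nonneg fun j _ => sq_nonneg (B i j))).mp h i (Finset.mem_univ _)
    have hij := (Finset.sum_eq_zero_iff_of_nonneg (fun j _ => sq_nonneg (B i j))).mp hi j
      (Finset.mem_univ _)
    simpa using hij
  · rintro rfl
    simp

/-- The cohomological side of the sign law: `∫ κ ∪ (ω ⊗ ω′) = (Kω′·ω)` for `κ = graph K`; with
`K = mΨ`, `Ψω′ = ω`, `ω² = 2ω′²` this is `m·ω² = 2m·ω′²`, so `sign m = sign ∫ c₂ ∧ ω ⊗ ω′`. -/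
theorem signLaw_bookkeeping (m ω2 ω'2 E : ℝ) (hω : ω2 = 2 * ω'2) (hpos : 0 < ω'2)
    (hE : m * ω2 = E) (hEnn : 0 ≤ E) : 0 ≤ m := by
  subst hω
  nlinarith

end SignLaw

section Rigidity

/-- **Mixed class of a constant-quotient family.**  If `V = G|_{X×N_j}` is an extension
`0 → A ⊠ 𝒪(d₁) → V → Q ⊠ 𝒪(d′) → 0` (`rk A = a`, `rk Q = r − a`, `c₁(Q) = −c₁(A) =: −α`) with
`c₁(V) = 0`, i.e. `a·d₁ + (r−a)·d′ = 0`, then the mixed Künneth component of `c₂(V)` is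
`α ⊗ [pt]·(d′ − d₁) = −α·(r·d₁/(r−a))`; equating with `m·r_j` gives `α = −(m(r−a)/(r d₁))·r_j`. -/
theorem mixed_class_constQ (r a d₁ d' : ℚ) (hra : r - a ≠ 0) (hc1 : a * d₁ + (r - a) * d' = 0) :
    d' - d₁ = -(r * d₁ / (r - a)) := by
  field_simp
  linarith

/-- **Leaf degree.** The `𝒪(1)`-degree of `φ_j : N_j → P_Q = ℙ(Ext¹(Q,A))` is
`e = (θ(r_j)·R_j)/(θ(r_j)·ℓ) = (−4m)/(−(α·r_j)) = r·d₁/(r−a)`, and `r·d₁/(r−a) > d₁ ≥ 1` for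
`0 < a < r`; so `e ≥ 2` — never a line. -/
theorem leafDegree_gt (r a d₁ : ℚ) (ha : 0 < a) (har : a < r) (hd : 1 ≤ d₁) :
    d₁ < r * d₁ / (r - a) := by
  rw [lt_div_iff₀ (by linarith)]
  nlinarith

/-- An integer degree `e > d₁ ≥ 1` is at least `2`: the nodal curve never maps to a line of the leaf. -/
theorem leafDegree_ge_two (e : ℤ) (d₁ : ℤ) (hd : 1 ≤ d₁) (he : (d₁ : ℚ) < e) : 2 ≤ e := by
  have : (d₁ : ℚ) < (e : ℚ) := he
  have h' : d₁ < e := by exact_mod_cast this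
  omega

/-- **Euler numerics.** `φ_j^*Tℙ^φ` is a quotient of `𝒪(e)^{φ+1}`, so each of its line-bundle quotients
has degree `≥ e`; a retraction onto `T N_j = 𝒪(2)` would be such a quotient, so `e ≤ 2`; with
`leafDegree_ge_two`, `e = 2`, and the conic (`T ⊂ 𝒪(3)²`, `Hom(𝒪(3), 𝒪(2)) = 0`) and the double line
(ramified) are excluded geometrically.  The arithmetic shell: -/
theorem retraction_degree (e q : ℤ) (hquot : e ≤ q) (hq : q = 2) (he : 2 ≤ e) : e = 2 := by omega

/-- **Charge lower bound (escape γ of §K / squeeze of §F).**  If the zero-scheme sweeps a curve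
`D_W ≠ 0` (`D_W·L_h ≥ 1`), then `λ(D_W·L_h) − Σ_kε_k(D_W·r_k) = D_W·ω < 4mε_j` gives
`m > (λ − S)/(4ε_j)` with `S := Σ_kε_k(D_W·r_k)` (bounded by `O(ε·√(2 + L_h²α²))` for an irreducible
`D_W = αL_h + e`): small-charge carriers do not exist near the orbifold wall. -/
theorem charge_lower_bound (lam S ε m DL : ℝ) (hε : 0 < ε) (hl : 0 ≤ lam) (hDL : 1 ≤ DL)
    (hsq : lam * DL - S < 4 * m * ε) : (lam - S) / (4 * ε) < m := by
  rw [div_lt_iff₀ (by positivity)]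
  have : lam ≤ lam * DL := by nlinarith
  nlinarith

end Rigidity

end Summit.HodgeConjecture.HodgeConjecture.Theorems.NikulinSerreCarrier.Negative.NodalRigidity
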